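import Mathlib.Analysis.PSeries
import Summits.RiemannHypothesis.RiemannHypothesis.Theorems.PfPersistenceGalerkinFourier
import HarnessLib

/-!
# GAL-1 piece (ii′), STEP B′: decay of the window Fourier coefficients of a flat `C³` function

Cell `pub-rhpf` (even-sector Pólya-frequency campaign; a long-odds MECHANISM SEARCH — no RH claims),
seat `barrier-prover` g2. RH-free harmonic analysis; nothing about `RiemannHypothesis` is asserted.

Three integrations by parts (Mathlib `fourierCoeffOn_of_hasDerivAt`) for a `C³` function `g` on `[-a, a]`
whose `g, g', g''` take equal values at `±a` (e.g. a test flat at `±a`): `‖c_n(g)‖ ≤ K/|n|³` with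
`K = (a/π)³ (1/2a) ∫_{-a}^{a} ‖g⁽³⁾‖` (`norm_testCoeff_le_of_flat3`), whence `Σ_ℤ ‖c_n‖ < ∞`
(`summable_norm_testCoeff_int`), `Σ_ℕ ‖c_n‖ < ∞` and `Σ_ℕ n ‖c_n‖ < ∞` — the inputs of the convergence,
sup and derivative bounds of `PfPersistenceGalerkinFourier`.
-/

noncomputable section

open Complex Filter Set MeasureTheory Topology Finset
open scoped Real ComplexConjugate Interval

namespace Summit.RiemannHypothesis.RiemannHypothesis.Theorems.PfPersistence

variable {a : ℝ} {g : ℝ → ℂ}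

/-! ## §6 Decay of the coefficients of a `C³` function flat at `±a` -/

/-- `‖fourierCoeffOn h n‖ ≤ (1/2a) ∫_{-a}^{a} ‖h‖`. [folklore] -/
theorem norm_fourierCoeffOn_le (hab : -a < a) (h : ℝ → ℂ) (n : ℤ) :
    ‖fourierCoeffOn hab h n‖ ≤ 1 / (2 * a) * ∫ x in (-a)..a, ‖h x‖ := by
  have ha : 0 < a := by linarith
  rw [fourierCoeffOn_eq_integral, norm_smul]
  have e1 : ‖(1 / (a - -a) : ℝ)‖ = 1 / (2 * a) := by
    rw [Real.norm_of_nonneg (by positivity)]; ring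
  rw [e1]
  refine mul_le_mul_of_nonneg_left ?_ (by positivity)
  refine (intervalIntegral.norm_integral_le_integral_norm hab.le).trans_eq ?_
  refine intervalIntegral.integral_congr fun x _ ↦ ?_
  simp only [norm_smul, fourier_apply, Circle.norm_coe, one_mul]

/-- **One integration by parts, flat ends**: `f(a) = f(-a)` ⇒ `‖ĉ_n(f)‖ = (a/(π|n|)) ‖ĉ_n(f')‖`.
[folklore] -/
theorem norm_fourierCoeffOn_eq_of_flat (hab : -a < a) {f f' : ℝ → ℂ} {n : ℤ} (hn : n ≠ 0)
    (hf : ∀ x, HasDerivAt f (f' x) x) (hf'c : Continuous f') (hflat : f a = f (-a)) :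
    ‖fourierCoeffOn hab f n‖ = a / (π * |(n : ℝ)|) * ‖fourierCoeffOn hab f' n‖ := by
  have ha : 0 < a := by linarith
  have key : fourierCoeffOn hab f n =
      -(((2 * a : ℝ) : ℂ) / (-2 * π * I * n)) * fourierCoeffOn hab f' n := by
    rw [fourierCoeffOn_of_hasDerivAt hab hn (fun x _ ↦ hf x) (hf'c.intervalIntegrable _ _), hflat,
      sub_self, mul_zero, zero_sub]
    push_cast
    ring
  rw [key, norm_mul, norm_neg, norm_div, Complex.norm_real, Real.norm_of_nonneg (by positivity)]
  have hden : ‖(-2 * π * I * n : ℂ)‖ = 2 * π * |(n : ℝ)| := by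
    rw [norm_mul, norm_mul, norm_mul, norm_neg, Complex.norm_ofNat, Complex.norm_real,
      Real.norm_of_nonneg Real.pi_pos.le, Complex.norm_I, mul_one, Complex.norm_intCast]
  rw [hden]
  congr 1
  have hn' : (0 : ℝ) < |(n : ℝ)| := by positivity
  field_simp

/-- **Three integrations by parts**: for `g ∈ C³` with `g, g', g''` taking equal values at `±a`,
`‖c_n(g)‖ ≤ (a/π)³ · ((1/2a) ∫_{-a}^{a} ‖g⁽³⁾‖) / |n|³` (`n ≠ 0`). [folklore] -/
theorem norm_testCoeff_le_of_flat3 (ha : 0 < a) {g₁ g₂ g₃ : ℝ → ℂ} (h0 : ∀ x, HasDerivAt g (g₁ x) x)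
    (h1 : ∀ x, HasDerivAt g₁ (g₂ x) x) (h2 : ∀ x, HasDerivAt g₂ (g₃ x) x) (hg₃ : Continuous g₃)
    (hf0 : g a = g (-a)) (hf1 : g₁ a = g₁ (-a)) (hf2 : g₂ a = g₂ (-a)) {n : ℤ} (hn : n ≠ 0) :
    ‖testCoeff a g n‖ ≤
      (a / π) ^ 3 * (1 / (2 * a) * ∫ x in (-a)..a, ‖g₃ x‖) / |(n : ℝ)| ^ 3 := by
  have hab : -a < a := by linarith
  have c1 : Continuous g₁ := continuous_iff_continuousAt.2 fun x ↦ (h1 x).continuousAt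
  have c2 : Continuous g₂ := continuous_iff_continuousAt.2 fun x ↦ (h2 x).continuousAt
  rw [testCoeff_eq_fourierCoeffOn hab, norm_fourierCoeffOn_eq_of_flat hab hn h0 c1 hf0,
    norm_fourierCoeffOn_eq_of_flat hab hn h1 c2 hf1, norm_fourierCoeffOn_eq_of_flat hab hn h2 hg₃ hf2]
  have hI := norm_fourierCoeffOn_le hab g₃ n
  have hn' : (0 : ℝ) < |(n : ℝ)| := by positivity
  have hq : 0 ≤ a / (π * |(n : ℝ)|) := by positivity
  calc a / (π * |(n : ℝ)|) * (a / (π * |(n : ℝ)|) * (a / (π * |(n : ℝ)|) * ‖fourierCoeffOn hab g₃ n‖))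
      = (a / (π * |(n : ℝ)|)) ^ 3 * ‖fourierCoeffOn hab g₃ n‖ := by ring
    _ ≤ (a / (π * |(n : ℝ)|)) ^ 3 * (1 / (2 * a) * ∫ x in (-a)..a, ‖g₃ x‖) :=
        mul_le_mul_of_nonneg_left hI (by positivity)
    _ = (a / π) ^ 3 * (1 / (2 * a) * ∫ x in (-a)..a, ‖g₃ x‖) / |(n : ℝ)| ^ 3 := by
        field_simp

/-- **Absolute summability over `ℤ`** of the window coefficients of such a `g`. [folklore] -/
theorem summable_norm_testCoeff_int (ha : 0 < a) {g₁ g₂ g₃ : ℝ → ℂ}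
    (h0 : ∀ x, HasDerivAt g (g₁ x) x) (h1 : ∀ x, HasDerivAt g₁ (g₂ x) x)
    (h2 : ∀ x, HasDerivAt g₂ (g₃ x) x) (hg₃ : Continuous g₃) (hf0 : g a = g (-a))
    (hf1 : g₁ a = g₁ (-a)) (hf2 : g₂ a = g₂ (-a)) :
    Summable fun n : ℤ ↦ ‖testCoeff a g n‖ := by
  set K : ℝ := (a / π) ^ 3 * (1 / (2 * a) * ∫ x in (-a)..a, ‖g₃ x‖) with hK
  have hInn : 0 ≤ ∫ x in (-a)..a, ‖g₃ x‖ :=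
    intervalIntegral.integral_nonneg (by linarith) fun x _ ↦ norm_nonneg _
  have hK0 : 0 ≤ K := by positivity
  have hbound : ∀ n : ℤ, ‖testCoeff a g n‖ ≤
      K * |1 / (n : ℝ) ^ 3| + if n = 0 then ‖testCoeff a g 0‖ else 0 := by
    intro n
    by_cases hn : n = 0
    · subst hn; simp
    · rw [if_neg hn, add_zero]
      calc ‖testCoeff a g n‖ ≤ K / |(n : ℝ)| ^ 3 :=
            norm_testCoeff_le_of_flat3 ha h0 h1 h2 hg₃ hf0 hf1 hf2 hn
        _ = K * |1 / (n : ℝ) ^ 3| := by rw [abs_div, abs_one, abs_pow]; ring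
  refine Summable.of_nonneg_of_le (fun n ↦ norm_nonneg _) hbound ?_
  exact (((Real.summable_one_div_int_pow.mpr (by norm_num : 1 < 3)).abs.mul_left K).add
    (hasSum_ite_eq (0 : ℤ) ‖testCoeff a g 0‖).summable)

/-- **Absolute summability over `ℕ`**. [folklore] -/
theorem summable_norm_testCoeff_nat (ha : 0 < a) {g₁ g₂ g₃ : ℝ → ℂ}
    (h0 : ∀ x, HasDerivAt g (g₁ x) x) (h1 : ∀ x, HasDerivAt g₁ (g₂ x) x)
    (h2 : ∀ x, HasDerivAt g₂ (g₃ x) x) (hg₃ : Continuous g₃) (hf0 : g a = g (-a))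
    (hf1 : g₁ a = g₁ (-a)) (hf2 : g₂ a = g₂ (-a)) :
    Summable fun n : ℕ ↦ ‖testCoeff a g n‖ :=
  (summable_norm_testCoeff_int ha h0 h1 h2 hg₃ hf0 hf1 hf2).comp_injective Nat.cast_injective

/-- **Summability of `n ‖c_n‖` over `ℕ`**. [folklore] -/
theorem summable_mul_norm_testCoeff_nat (ha : 0 < a) {g₁ g₂ g₃ : ℝ → ℂ}
    (h0 : ∀ x, HasDerivAt g (g₁ x) x) (h1 : ∀ x, HasDerivAt g₁ (g₂ x) x)
    (h2 : ∀ x, HasDerivAt g₂ (g₃ x) x) (hg₃ : Continuous g₃) (hf0 : g a = g (-a))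
    (hf1 : g₁ a = g₁ (-a)) (hf2 : g₂ a = g₂ (-a)) :
    Summable fun n : ℕ ↦ (n : ℝ) * ‖testCoeff a g n‖ := by
  set K : ℝ := (a / π) ^ 3 * (1 / (2 * a) * ∫ x in (-a)..a, ‖g₃ x‖) with hK
  have hInn : 0 ≤ ∫ x in (-a)..a, ‖g₃ x‖ :=
    intervalIntegral.integral_nonneg (by linarith) fun x _ ↦ norm_nonneg _
  have hK0 : 0 ≤ K := by positivity
  have hbound : ∀ n : ℕ, (n : ℝ) * ‖testCoeff a g n‖ ≤ K * (1 / (n : ℝ) ^ 2) := by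
    intro n
    rcases Nat.eq_zero_or_pos n with hn | hn
    · subst hn; simp
    · have hn' : (n : ℤ) ≠ 0 := by exact_mod_cast hn.ne'
      have hb := norm_testCoeff_le_of_flat3 ha h0 h1 h2 hg₃ hf0 hf1 hf2 hn'
      rw [Int.cast_natCast, Nat.abs_cast] at hb
      have hnpos : (0 : ℝ) < n := by exact_mod_cast hn
      calc (n : ℝ) * ‖testCoeff a g n‖ ≤ n * (K / (n : ℝ) ^ 3) :=
            mul_le_mul_of_nonneg_left hb hnpos.le
        _ = K * (1 / (n : ℝ) ^ 2) := by field_simp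
  refine Summable.of_nonneg_of_le (fun n ↦ by positivity) hbound ?_
  exact (Real.summable_one_div_nat_pow.mpr (by norm_num : 1 < 2)).mul_left K

end Summit.RiemannHypothesis.RiemannHypothesis.Theorems.PfPersistence
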